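import Mathlib
import HarnessLib

/-!
# A 2-dimensional symplectic 𝔽₂-space: `e x w = 0` with `w ≠ 0` forces `x ∈ {0, w}`
# (lemma (f) of the DEPTH-ONE first-block argument for K4Neg, `Cruxes/GenusDeepSupplyAtTwoNegDiscNarrow/DEPTH-ONE-FIRST-BLOCK-g23.md` §4)

LEAD seat `bsd-line-gk2-p1` g23 (cell `bsd-f1-sign2`), `--supports stmt-BirchSwinnertonDyer-31526 --as helper`.  THEOREMS ONLY; pure group theory
(Mathlib only; route-independent module).  **BSD is NOT proved by this; nothing is closed.**

WHY.  The tree's Poitou–Tate reciprocity at a Kolyvagin prime (`McCallum1991.LeafProofs.kolyvaginReciprocityFinset_of_poitouTate_of_hasGoodReductionAt`)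
hands an ABSTRACT pairing `e : E[p^M] →+ E[p^M] →+ A` with exactly two properties — alternating (`e x x = 0`) and left-non-degenerate — and concludes
`e (s F) (c' σ) = 0`.  In the depth-one argument (`p^M = 2`) this is read on `E[2]`, an elementary abelian `2`-group of order `4`: for a fixed non-zero
ramified value `w`, every Selmer value `x = s(F)` satisfies `e x w = 0`, hence — this file — `x = 0 ∨ x = w` (the annihilator of a non-zero vector in a
2-dimensional symplectic space is the line it spans).  Stated for any abelian group `V` of order `4` killed by `2`. [folklore]
-/

set_option autoImplicit false
set_option linter.dupNamespace false -- `Summit.<P>.<Sub>` repeats `BirchSwinnertonDyer` (D-0017)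

namespace Summit.BirchSwinnertonDyer.BirchSwinnertonDyer.Theorems.GenusSupplyNarrow.DepthOne

/-- **Antisymmetry from alternation**: `e x y = - e y x` for an alternating bi-additive pairing. [folklore] -/
theorem pairing_antisymm {V A : Type*} [AddCommGroup V] [AddCommGroup A] (e : V →+ V →+ A) (halt : ∀ v : V, e v v = 0)
    (x y : V) : e x y = -e y x := by
  have h := halt (x + y)
  simp only [map_add, AddMonoidHom.add_apply, halt x, halt y, zero_add, add_zero] at h
  -- `h : e x y + e y x = 0`
  rw [add_comm] at h
  exact eq_neg_of_add_eq_zero_left h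

/-- **In an abelian group of order `4` killed by `2`, carrying an alternating left-non-degenerate pairing, the annihilator of a non-zero `w` is `{0, w}`**:
`e x w = 0`, `w ≠ 0` ⟹ `x = 0 ∨ x = w`.  Proof: otherwise `V = {0, w, x, x + w}` and `w` pairs to zero with all four (`e w x = -e x w = 0`,
`e w w = 0`), contradicting non-degeneracy. [folklore] -/
theorem eq_zero_or_eq_of_pairing_eq_zero {V A : Type*} [AddCommGroup V] [AddCommGroup A] (hV : Nat.card V = 4)
    (h2 : ∀ v : V, 2 • v = 0) (e : V →+ V →+ A) (halt : ∀ v : V, e v v = 0) (hnd : ∀ x : V, (∀ y : V, e x y = 0) → x = 0)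
    {w x : V} (hw : w ≠ 0) (hxw : e x w = 0) : x = 0 ∨ x = w := by
  classical
  by_contra hcon
  have hx0 : x ≠ 0 := fun h ↦ hcon (Or.inl h)
  have hxw' : x ≠ w := fun h ↦ hcon (Or.inr h)
  haveI : Finite V := Nat.finite_of_card_ne_zero (by rw [hV]; norm_num)
  letI : Fintype V := Fintype.ofFinite V
  -- `-v = v` in `V`
  have hneg : ∀ v : V, -v = v := fun v ↦ by
    rw [neg_eq_iff_add_eq_zero, ← two_nsmul]
    exact h2 v
  -- the four elements `0, w, x, x + w` are distinct
  have h1 : x + w ≠ 0 := fun h ↦ hxw' (by rw [add_eq_zero_iff_eq_neg, hneg] at h; exact h)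
  have h2' : x + w ≠ x := fun h ↦ hw (by simpa using h)
  have h3 : x + w ≠ w := fun h ↦ hx0 (by simpa using h)
  -- hence they exhaust `V`
  have hS : ({0, w, x, x + w} : Finset V) = Finset.univ := by
    apply Finset.eq_univ_of_card
    rw [← Nat.card_eq_fintype_card, hV]
    rw [Finset.card_insert_of_notMem, Finset.card_insert_of_notMem, Finset.card_insert_of_notMem, Finset.card_singleton]
    · simp only [Finset.mem_singleton]; exact fun h ↦ h2' h.symm
    · simp only [Finset.mem_insert, Finset.mem_singleton, not_or]; exact ⟨fun h ↦ hxw' h.symm, fun h ↦ h3 h.symm⟩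
    · simp only [Finset.mem_insert, Finset.mem_singleton, not_or]; exact ⟨hw.symm, hx0.symm, h1.symm⟩
  -- `w` pairs to zero with everything
  have hwx : e w x = 0 := by rw [pairing_antisymm e halt w x, hxw, neg_zero]
  have hall : ∀ y : V, e w y = 0 := by
    intro y
    have hy : y ∈ ({0, w, x, x + w} : Finset V) := by rw [hS]; exact Finset.mem_univ y
    simp only [Finset.mem_insert, Finset.mem_singleton] at hy
    rcases hy with hy | hy | hy | hy <;> rw [hy]
    · exact map_zero _
    · exact halt w
    · exact hwx
    · rw [map_add, hwx, halt w, add_zero]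
  exact hw (hnd w hall)

end Summit.BirchSwinnertonDyer.BirchSwinnertonDyer.Theorems.GenusSupplyNarrow.DepthOne
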